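import Literature.Geometry.Kaehler.AlternatingFormInnerTransport
import Literature.NumberTheory.Transcendental.L2HodgeTheoryAddLeftProofs
import Literature.NumberTheory.Transcendental.FormIntegrationPullbackProofs
import Literature.NumberTheory.Transcendental.FormIntegrationNonnegProofs
import Literature.NumberTheory.Transcendental.ComplexDeRhamRealStructure
import HarnessLib

/-!
# Transport of the `L²` product of forms along an almost isometric diffeomorphism

Topic: the `L²` metric on forms of a compact oriented Riemannian manifold (Voisin (2002), §5.1.1,
eq. (5.1); Warner (1983), 6.1) and its behaviour under a diffeomorphism `Φ : M₀ → M₁` whose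
differential is uniformly close to an isometry. This is the manifold-level ("integrated")
companion of the pointwise estimate
`Literature.Geometry.Kaehler.abs_inner_transport_mul_volumeForm_sub_le` of
`AlternatingFormInnerTransport.lean`, and is the analytic input of the *soft* proof of the upper
semicontinuity of the Hodge numbers `h^{p,q}(X_s)` in a smooth projective family (Voisin (2002),
§9.3, Prop. 9.20 / Kodaira–Spencer): there one compares the `L²` products of the fibres
`(X_s, g_s)` after transport to the central fibre by the Ehresmann diffeomorphisms `Φ_s`, whose
differentials tend to isometries as `s → s₀`.

* `mfderiv_symm_comp_mfderiv`, `mfderivToContinuousLinearEquiv_symm_apply`,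
  `pullback_symm_apply_apply` — the differential of `Φ⁻¹` at `Φ x` inverts `DΦ(x)`, and the
  value at `Φ x` of the push-forward `(Φ⁻¹)^* α` is `α_x ∘ Λ^k (DΦ(x))⁻¹` (Lee (2013), Prop. 3.6
  / Cor. 3.7 for the chain rule; Warner (1983), 2.22 for the pull-back).
* `compContinuousLinearMap_inner_smul_riemannianVolumeForm`, `l2Inner_eq_integral_transport` — the
  change of variables `(α', β')_{L²(M₁)} = ∫_{M₀} ⟨α', β'⟩_{Φ x} · vol_{o₁}(DΦ(x) b) · vol_{o₀}`
  for a positively oriented orthonormal frame `b` of `T_x M₀` (Warner (1983), 4.8 (5),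
  diffeomorphism invariance of `∫`, in the tree `MForm.integral_pullback_holds`).
* `abs_integral_sub_l2Inner_le` — a pointwise bound `|F - ⟨α, β⟩| ≤ ε (|α|² + |β|²)` integrates to
  `|∫ F vol - (α, β)_{L²}| ≤ ε (‖α‖² + ‖β‖²)` (positivity and linearity of `∫_M`, Lee (2013),
  Prop. 16.6).
* `exists_forall_abs_l2Inner_transport_sub_le` — **main (real) statement**: for every `ε > 0`
  there is `δ₀ = δ₀(n, k, ε) > 0` such that for every compact oriented Riemannian `M₁`, every
  orientation-compatible diffeomorphism `Φ : M₀ → M₁` whose differentials have Gram defect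
  `≤ δ ≤ δ₀` on positively oriented orthonormal frames, and all smooth `k`-forms `α, β` on `M₀`,
  `|((Φ⁻¹)^*α, (Φ⁻¹)^*β)_{L²(M₁)} - (α, β)_{L²(M₀)}| ≤ ε (‖α‖² + ‖β‖²)`.
* `exists_forall_norm_cl2Inner_transport_sub_le` — the same for the Hermitian product
  `MForm.cl2Inner` of complex forms (constant `2ε`), via real and imaginary parts.

Everything is proved; no named fact is introduced.

## References

* C. Voisin, *Hodge Theory and Complex Algebraic Geometry I*, CUP (2002), §5.1.1 eq. (5.1)
  (the `L²` metric), §9.3.2, Prop. 9.20 / Thm. 9.23 (semicontinuity of `h^{p,q}`); held text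
  `book:voisin2002-hodge-theory-complex-algebraic-geometry-i`. [cite: VoisinHodgeI2002, §5.1.1]
* F. W. Warner, *Foundations of Differentiable Manifolds and Lie Groups*, GTM 94 (1983), 2.22,
  4.8 (5), 6.1.
* J. M. Lee, *Introduction to Smooth Manifolds*, 2nd ed. (2013), Prop. 3.6, Prop. 16.6.
-/

noncomputable section

open scoped Manifold ContDiff Topology RealInnerProductSpace
open Bundle Module Set Filter Function
open Literature.NumberTheory.Transcendental

namespace Literature.Geometry.Kaehler

-- The identification `TangentSpace I x = E` is an abuse of definitional equality (see
-- `NormedSpace.fromTangentSpace`); as in Mathlib's tangent-bundle files we let `isDefEq` unfold it.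
set_option backward.isDefEq.respectTransparency false

universe u₁ u₂ u₃

/-! ### Differentials of a diffeomorphism and of its inverse -/

section Diffeo

variable {E₀ : Type*} [NormedAddCommGroup E₀] [NormedSpace ℝ E₀]
  {E₁ : Type*} [NormedAddCommGroup E₁] [NormedSpace ℝ E₁]
  {H₀ : Type*} [TopologicalSpace H₀] {I₀ : ModelWithCorners ℝ E₀ H₀}
  {H₁ : Type*} [TopologicalSpace H₁] {I₁ : ModelWithCorners ℝ E₁ H₁}
  {M₀ : Type*} [TopologicalSpace M₀] [ChartedSpace H₀ M₀]
  {M₁ : Type*} [TopologicalSpace M₁] [ChartedSpace H₁ M₁]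

/-- For a diffeomorphism `Φ`, `D(Φ⁻¹)(Φ x) ∘ DΦ(x) = id` (chain rule applied to `Φ⁻¹ ∘ Φ = id`;
Lee (2013), Prop. 3.6 (b), (d)). [cite: LeeSmoothManifolds2013, Prop. 3.6] -/
theorem mfderiv_symm_comp_mfderiv (Φ : Diffeomorph I₀ I₁ M₀ M₁ ∞) (x : M₀) :
    (mfderiv I₁ I₀ Φ.symm (Φ x)).comp (mfderiv I₀ I₁ Φ x) =
      ContinuousLinearMap.id ℝ (TangentSpace I₀ x) := by
  rw [← mfderiv_comp x (Φ.symm.mdifferentiable (by simp) (Φ x)) (Φ.mdifferentiable (by simp) x)]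
  have hid : ((Φ.symm : M₁ → M₀) ∘ (Φ : M₀ → M₁)) = id := funext fun y ↦ Φ.symm_apply_apply y
  rw [hid]
  exact mfderiv_id

/-- The inverse of the differential `DΦ(x) : T_x M₀ ≃ T_{Φ x} M₁` of a diffeomorphism (Mathlib's
`Diffeomorph.mfderivToContinuousLinearEquiv`) is the differential of `Φ⁻¹` at `Φ x`
(Lee (2013), Prop. 3.6 (d)). [cite: LeeSmoothManifolds2013, Prop. 3.6] -/
theorem mfderivToContinuousLinearEquiv_symm_apply (Φ : Diffeomorph I₀ I₁ M₀ M₁ ∞) (x : M₀)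
    (w : TangentSpace I₁ (Φ x)) :
    (Φ.mfderivToContinuousLinearEquiv (by simp) x).symm w = mfderiv I₁ I₀ Φ.symm (Φ x) w := by
  set T := Φ.mfderivToContinuousLinearEquiv (by simp) x
  obtain ⟨v, rfl⟩ : ∃ v, T v = w := ⟨T.symm w, T.apply_symm_apply w⟩
  rw [T.symm_apply_apply]
  have h := ContinuousLinearMap.ext_iff.1 (mfderiv_symm_comp_mfderiv Φ x) v
  exact h.symm

/-- **The push-forward of a form, evaluated at the image point**: for a diffeomorphism `Φ` and a
`k`-form `α` on `M₀`, `((Φ⁻¹)^* α)(Φ x) = α_x ∘ Λ^k (DΦ(x))⁻¹` (Warner (1983), 2.22 with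
Lee (2013), Prop. 3.6 (d)). [cite: Warner1983, 2.22] -/
theorem pullback_symm_apply_apply {F : Type*} [NormedAddCommGroup F] [NormedSpace ℝ F] {k : ℕ}
    (Φ : Diffeomorph I₀ I₁ M₀ M₁ ∞) (α : MForm I₀ M₀ F k) (x : M₀) :
    α.pullback I₁ Φ.symm (Φ x) =
      (α x).compContinuousLinearMap
        ((Φ.mfderivToContinuousLinearEquiv (by simp) x).symm :
          TangentSpace I₁ (Φ x) →L[ℝ] TangentSpace I₀ x) := by
  have key : ∀ z : M₀, z = x → ∀ (L : TangentSpace I₁ (Φ x) →L[ℝ] TangentSpace I₀ z)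
      (L' : TangentSpace I₁ (Φ x) →L[ℝ] TangentSpace I₀ x), (∀ w, L w = L' w) →
      (α z).compContinuousLinearMap L = (α x).compContinuousLinearMap L' := by
    rintro z rfl L L' hLL'
    rw [ContinuousLinearMap.ext hLL']
  exact key _ (Φ.symm_apply_apply x) (mfderiv I₁ I₀ Φ.symm (Φ x)) _
    fun w ↦ (mfderivToContinuousLinearEquiv_symm_apply Φ x w).symm

end Diffeo

/-! ### Change of variables in the `L²` product -/

section Real

variable {E₀ : Type*} [NormedAddCommGroup E₀] [NormedSpace ℝ E₀] [FiniteDimensional ℝ E₀]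
  {E₁ : Type*} [NormedAddCommGroup E₁] [NormedSpace ℝ E₁] [FiniteDimensional ℝ E₁]
  {n : ℕ} [Fact (finrank ℝ E₀ = n)] [Fact (finrank ℝ E₁ = n)]
  {H₀ : Type*} [TopologicalSpace H₀] {I₀ : ModelWithCorners ℝ E₀ H₀}
  {H₁ : Type*} [TopologicalSpace H₁] {I₁ : ModelWithCorners ℝ E₁ H₁}
  {M₀ : Type*} [TopologicalSpace M₀] [ChartedSpace H₀ M₀]
  {M₁ : Type*} [TopologicalSpace M₁] [ChartedSpace H₁ M₁]
  [RiemannianBundle (fun x : M₀ ↦ TangentSpace I₀ x)]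
  [RiemannianBundle (fun y : M₁ ↦ TangentSpace I₁ y)]
  (o₀ : (x : M₀) → Orientation ℝ (TangentSpace I₀ x) (Fin n))
  (o₁ : (y : M₁) → Orientation ℝ (TangentSpace I₁ y) (Fin n)) {k : ℕ}

omit [FiniteDimensional ℝ E₀] in
/-- **Pull-back of the `L²` integrand, pointwise**: for `k`-forms `α', β'` on `M₁`, a
diffeomorphism `Φ` and a positively oriented orthonormal frame `b` of `T_x M₀`,
`Φ^*(⟨α', β'⟩ vol_{o₁})(x) = ⟨α', β'⟩(Φ x) · vol_{o₁ (Φ x)}(DΦ(x) b) · vol_{o₀}(x)`: a top-degree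
form pulls back along `DΦ(x)` to the multiple `vol_{o₁}(DΦ(x) b₁, …, DΦ(x) bₙ)` of `vol_{o₀}(x)`
(`volumeFormL_compContinuousLinearMap_eq_smul`). Warner (1983), 4.8 (change of variables
integrand); Lee (2013), Prop. 15.31. [cite: Warner1983, 4.8] -/
theorem compContinuousLinearMap_inner_smul_riemannianVolumeForm (α' β' : MForm I₁ M₁ ℝ k)
    (Φ : Diffeomorph I₀ I₁ M₀ M₁ ∞) (x : M₀) (b : OrthonormalBasis (Fin n) ℝ (TangentSpace I₀ x))
    (hb : b.toBasis.orientation = o₀ x) :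
    (MForm.inner n α' β' (Φ x) • riemannianVolumeForm o₁ (Φ x)).compContinuousLinearMap
        (mfderiv I₀ I₁ Φ x) =
      (MForm.inner n α' β' (Φ x) * (o₁ (Φ x)).volumeForm (mfderiv I₀ I₁ Φ x ∘ b)) •
        riemannianVolumeForm o₀ x := by
  have hs : ∀ (c : ℝ) (f : TangentSpace I₁ (Φ x) [⋀^Fin n]→L[ℝ] ℝ),
      (c • f).compContinuousLinearMap (mfderiv I₀ I₁ Φ x) =
        c • f.compContinuousLinearMap (mfderiv I₀ I₁ Φ x) := fun c f ↦ by
    ext v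
    simp [ContinuousAlternatingMap.compContinuousLinearMap_apply]
  rw [riemannianVolumeForm_apply, riemannianVolumeForm_apply, hs,
    volumeFormL_compContinuousLinearMap_eq_smul (o₀ x) (o₁ (Φ x)) (mfderiv I₀ I₁ Φ x) b hb,
    smul_smul]

variable [MeasurableSpace E₀] [BorelSpace E₀] [MeasurableSpace E₁] [BorelSpace E₁]
  [T2Space M₀] [CompactSpace M₀] [IsManifold I₀ ∞ M₀]
  [T2Space M₁] [CompactSpace M₁] [IsManifold I₁ ∞ M₁]

/-- **Change of variables in the `L²` product.** For an orientation-compatible diffeomorphism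
`Φ : M₀ → M₁` onto a compact manifold with smooth metric and smooth volume form `vol_{o₁}`, smooth
`k`-forms `α', β'` on `M₁`, and any field `b` of positively oriented orthonormal frames of `M₀`,
`(α', β')_{L²(M₁)} = ∫_{M₀} ⟨α', β'⟩(Φ x) · vol_{o₁ (Φ x)}(DΦ(x) b(x)) · vol_{o₀}`
(diffeomorphism invariance of the integral, Warner (1983), 4.8 (5) — in the tree
`MForm.integral_pullback_holds` — and the pointwise formula
`compContinuousLinearMap_inner_smul_riemannianVolumeForm`). [cite: Warner1983, 4.8(5)] -/
theorem l2Inner_eq_integral_transport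
    [IsContMDiffRiemannianBundle I₁ ∞ E₁ (fun y : M₁ ↦ TangentSpace I₁ y)]
    (ho₁ : IsSmoothForm (riemannianVolumeForm o₁)) (Φ : Diffeomorph I₀ I₁ M₀ M₁ ∞)
    (hΦ : ∀ x, Orientation.map (Fin n) (Φ.mfderivToContinuousLinearEquiv (by simp) x).toLinearEquiv
      (o₀ x) = o₁ (Φ x))
    (b : ∀ x : M₀, OrthonormalBasis (Fin n) ℝ (TangentSpace I₀ x))
    (hb : ∀ x, (b x).toBasis.orientation = o₀ x)
    {α' β' : MForm I₁ M₁ ℝ k} (hα' : IsSmoothForm α') (hβ' : IsSmoothForm β') :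
    MForm.l2Inner o₁ α' β' = MForm.integral o₀ (fun x ↦
      (MForm.inner n α' β' (Φ x) * (o₁ (Φ x)).volumeForm (mfderiv I₀ I₁ Φ x ∘ b x)) •
        riemannianVolumeForm o₀ x) := by
  haveI : IsContinuousRiemannianBundle E₁ (fun y : M₁ ↦ TangentSpace I₁ y) :=
    isContinuousRiemannianBundle_of_isContMDiffRiemannianBundle I₁ ∞
  have ho₁c : IsContinuousOrientation o₁ :=
    isContinuousOrientation_of_isSmoothForm_riemannianVolumeForm_holds o₁ ho₁
  have hsm : IsSmoothForm (fun y ↦ MForm.inner n α' β' y • riemannianVolumeForm o₁ y) :=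
    hα'.inner_smul_riemannianVolumeForm hβ' o₁ ho₁
  refine (MForm.integral_pullback_holds o₀ o₁ ho₁c Φ hΦ hsm).symm.trans ?_
  congr 1
  funext x
  exact compContinuousLinearMap_inner_smul_riemannianVolumeForm o₀ o₁ α' β' Φ x (b x) (hb x)

/-- **Integrating a pointwise comparison.** On a compact manifold with smooth metric and smooth
volume form `vol_{o₀}`, if a smooth density `F` satisfies `|F - ⟨α, β⟩| ≤ ε (⟨α, α⟩ + ⟨β, β⟩)`
pointwise for smooth `k`-forms `α, β`, then `|∫ F vol - (α, β)_{L²}| ≤ ε (‖α‖² + ‖β‖²)_{L²}`: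
linearity of `∫_M` on smooth top forms (Lee (2013), Prop. 16.6 (a); `MForm.integral_add_holds`)
and `∫ f vol ≥ 0` for `f ≥ 0` (Prop. 16.6 (c); `integral_smul_riemannianVolumeForm_nonneg_holds`)
applied to `f = ε (⟨α, α⟩ + ⟨β, β⟩) ∓ (F - ⟨α, β⟩)`. [cite: LeeSmoothManifolds2013, Prop. 16.6] -/
theorem abs_integral_sub_l2Inner_le
    [IsContMDiffRiemannianBundle I₀ ∞ E₀ (fun x : M₀ ↦ TangentSpace I₀ x)]
    (ho₀ : IsSmoothForm (riemannianVolumeForm o₀)) {F : M₀ → ℝ}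
    (hF : IsSmoothForm (fun x ↦ F x • riemannianVolumeForm o₀ x))
    {α β : MForm I₀ M₀ ℝ k} (hα : IsSmoothForm α) (hβ : IsSmoothForm β) {ε : ℝ}
    (hpt : ∀ x, |F x - MForm.inner n α β x| ≤ ε * (MForm.inner n α α x + MForm.inner n β β x)) :
    |MForm.integral o₀ (fun x ↦ F x • riemannianVolumeForm o₀ x) - MForm.l2Inner o₀ α β| ≤
      ε * (MForm.l2Inner o₀ α α + MForm.l2Inner o₀ β β) := by
  haveI : IsContinuousRiemannianBundle E₀ (fun x : M₀ ↦ TangentSpace I₀ x) :=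
    isContinuousRiemannianBundle_of_isContMDiffRiemannianBundle I₀ ∞
  have ho₀c : IsContinuousOrientation o₀ :=
    isContinuousOrientation_of_isSmoothForm_riemannianVolumeForm_holds o₀ ho₀
  -- the four smooth top forms
  set vol := riemannianVolumeForm o₀ with hvol
  set A : MForm I₀ M₀ ℝ n := fun x ↦ F x • vol x with hA
  set G : MForm I₀ M₀ ℝ n := fun x ↦ MForm.inner n α β x • vol x with hG
  set Pa : MForm I₀ M₀ ℝ n := fun x ↦ MForm.inner n α α x • vol x with hPa
  set Pb : MForm I₀ M₀ ℝ n := fun x ↦ MForm.inner n β β x • vol x with hPb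
  have hAs : IsSmoothForm A := hF
  have hGs : IsSmoothForm G := hα.inner_smul_riemannianVolumeForm hβ o₀ ho₀
  have hPas : IsSmoothForm Pa := hα.inner_smul_riemannianVolumeForm hα o₀ ho₀
  have hPbs : IsSmoothForm Pb := hβ.inner_smul_riemannianVolumeForm hβ o₀ ho₀
  have hl2 : ∀ γ γ' : MForm I₀ M₀ ℝ k, MForm.l2Inner o₀ γ γ' =
      MForm.integral o₀ (fun x ↦ MForm.inner n γ γ' x • vol x) := fun _ _ ↦ rfl
  -- `∫ (ε P ∓ (F - G)) vol = ε ‖α‖² + ε ‖β‖² ∓ (∫ F vol - (α, β))`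
  have hlin : ∀ σ : ℝ, MForm.integral o₀ (fun x ↦
      (ε * (MForm.inner n α α x + MForm.inner n β β x) + σ * (F x - MForm.inner n α β x)) • vol x) =
      ε * MForm.l2Inner o₀ α α + ε * MForm.l2Inner o₀ β β +
        σ * (MForm.integral o₀ A - MForm.l2Inner o₀ α β) := by
    intro σ
    have hform : (fun x ↦ (ε * (MForm.inner n α α x + MForm.inner n β β x) +
        σ * (F x - MForm.inner n α β x)) • vol x) =
        (ε • Pa + ε • Pb) + (σ • A + (-σ) • G) := by
      funext x
      ext v
      simp only [hA, hG, hPa, hPb, Pi.add_apply, Pi.smul_apply,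
        ContinuousAlternatingMap.add_apply, ContinuousAlternatingMap.smul_apply, smul_eq_mul]
      ring
    rw [hform, MForm.integral_add_holds o₀ ho₀c ((hPas.smul ε).add (hPbs.smul ε))
        ((hAs.smul σ).add (hGs.smul (-σ))),
      MForm.integral_add_holds o₀ ho₀c (hPas.smul ε) (hPbs.smul ε),
      MForm.integral_add_holds o₀ ho₀c (hAs.smul σ) (hGs.smul (-σ)),
      MForm.integral_smul, MForm.integral_smul, MForm.integral_smul, MForm.integral_smul,
      hl2 α α, hl2 β β, hl2 α β]
    ring
  have hnonneg : ∀ σ : ℝ, σ = 1 ∨ σ = -1 → 0 ≤ ε * MForm.l2Inner o₀ α α +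
      ε * MForm.l2Inner o₀ β β + σ * (MForm.integral o₀ A - MForm.l2Inner o₀ α β) := by
    intro σ hσ
    rw [← hlin σ]
    refine integral_smul_riemannianVolumeForm_nonneg_holds o₀ fun x ↦ ?_
    have h := hpt x
    rw [abs_le] at h
    rcases hσ with rfl | rfl <;> nlinarith [h.1, h.2]
  have h1 := hnonneg 1 (Or.inl rfl)
  have h2 := hnonneg (-1) (Or.inr rfl)
  rw [abs_le]
  constructor <;> nlinarith [h1, h2]

/-- **Transport of the `L²` product along an almost isometric diffeomorphism (real forms).**
Fix a compact oriented Riemannian manifold `(M₀, g₀, o₀)` (smooth metric, smooth `vol_{o₀}`), a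
field `b` of positively oriented orthonormal frames, a degree `k` and `ε > 0`. There is
`δ₀ > 0` (depending only on `n = dim M₀`, `k`, `ε`) such that: for every compact oriented
Riemannian `(M₁, g₁, o₁)` of the same dimension (smooth metric, smooth `vol_{o₁}`), every
orientation-compatible diffeomorphism `Φ : M₀ → M₁` whose differentials have Gram defect
`|g₁(DΦ bᵢ, DΦ bⱼ) - δᵢⱼ| ≤ δ ≤ δ₀` everywhere, and all smooth `k`-forms `α, β` on `M₀`,
`|((Φ⁻¹)^*α, (Φ⁻¹)^*β)_{L²(M₁)} - (α, β)_{L²(M₀)}| ≤ ε ((α, α) + (β, β))_{L²(M₀)}`.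
Proof: change of variables (`l2Inner_eq_integral_transport`), the pointwise transport estimate
`abs_inner_transport_mul_volumeForm_sub_le` at every `x` (with `V₀ = T_x M₀`,
`V₁ = T_{Φ x} M₁`, `T = DΦ(x)`, using `((Φ⁻¹)^*α)(Φ x) = α_x ∘ Λ^k T⁻¹`,
`pullback_symm_apply_apply`), and integration of the pointwise comparison
(`abs_integral_sub_l2Inner_le`). This is the metric-comparison step of the soft proof of
Voisin (2002), Prop. 9.20 (Kodaira–Spencer upper semicontinuity). [cite: VoisinHodgeI2002, §9.3.2, Prop. 9.20] -/
theorem exists_forall_abs_l2Inner_transport_sub_le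
    [IsContMDiffRiemannianBundle I₀ ∞ E₀ (fun x : M₀ ↦ TangentSpace I₀ x)]
    (ho₀ : IsSmoothForm (riemannianVolumeForm o₀))
    (b : ∀ x : M₀, OrthonormalBasis (Fin n) ℝ (TangentSpace I₀ x))
    (hb : ∀ x, (b x).toBasis.orientation = o₀ x) (k : ℕ) {ε : ℝ} (hε : 0 < ε) :
    ∃ δ₀ : ℝ, 0 < δ₀ ∧ ∀ {E₁ : Type u₁} [NormedAddCommGroup E₁] [NormedSpace ℝ E₁]
      [FiniteDimensional ℝ E₁] [Fact (finrank ℝ E₁ = n)] [MeasurableSpace E₁] [BorelSpace E₁]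
      {H₁ : Type u₂} [TopologicalSpace H₁] {I₁ : ModelWithCorners ℝ E₁ H₁}
      {M₁ : Type u₃} [TopologicalSpace M₁] [ChartedSpace H₁ M₁] [T2Space M₁] [CompactSpace M₁]
      [IsManifold I₁ ∞ M₁] [RiemannianBundle (fun y : M₁ ↦ TangentSpace I₁ y)]
      [IsContMDiffRiemannianBundle I₁ ∞ E₁ (fun y : M₁ ↦ TangentSpace I₁ y)]
      (o₁ : (y : M₁) → Orientation ℝ (TangentSpace I₁ y) (Fin n))
      (_ho₁ : IsSmoothForm (riemannianVolumeForm o₁)) (Φ : Diffeomorph I₀ I₁ M₀ M₁ ∞)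
      (_hΦ : ∀ x, Orientation.map (Fin n)
        (Φ.mfderivToContinuousLinearEquiv (by simp) x).toLinearEquiv (o₀ x) = o₁ (Φ x))
      {δ : ℝ} (_hδ0 : 0 ≤ δ) (_hδ : δ ≤ δ₀)
      (_hT : ∀ x i j, |⟪mfderiv I₀ I₁ Φ x (b x i), mfderiv I₀ I₁ Φ x (b x j)⟫ -
        (if i = j then 1 else 0)| ≤ δ)
      {α β : MForm I₀ M₀ ℝ k} (_hα : IsSmoothForm α) (_hβ : IsSmoothForm β),
      |MForm.l2Inner o₁ (α.pullback I₁ Φ.symm) (β.pullback I₁ Φ.symm) - MForm.l2Inner o₀ α β| ≤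
        ε * (MForm.l2Inner o₀ α α + MForm.l2Inner o₀ β β) := by
  obtain ⟨δ₀, hδ₀, hB⟩ := abs_inner_transport_mul_volumeForm_sub_le n k hε
  refine ⟨δ₀, hδ₀, ?_⟩
  intro E₁ _ _ _ _ _ _ H₁ _ I₁ M₁ _ _ _ _ _ _ _ o₁ ho₁ Φ hΦ δ hδ0 hδ hT α β hα hβ
  have hΦC : ContMDiff I₁ I₀ ∞ Φ.symm := Φ.symm.contMDiff
  have hα' : IsSmoothForm (α.pullback I₁ Φ.symm) := isSmoothForm_pullback hΦC hα
  have hβ' : IsSmoothForm (β.pullback I₁ Φ.symm) := isSmoothForm_pullback hΦC hβ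
  rw [l2Inner_eq_integral_transport o₀ o₁ ho₁ Φ hΦ b hb hα' hβ']
  -- the transported density is smooth: it is the pull-back of the smooth integrand of `M₁`
  have hF : IsSmoothForm (fun x ↦ (MForm.inner n (α.pullback I₁ Φ.symm) (β.pullback I₁ Φ.symm)
      (Φ x) * (o₁ (Φ x)).volumeForm (mfderiv I₀ I₁ Φ x ∘ b x)) • riemannianVolumeForm o₀ x) := by
    have hsm : IsSmoothForm (fun y ↦ MForm.inner n (α.pullback I₁ Φ.symm) (β.pullback I₁ Φ.symm)
        y • riemannianVolumeForm o₁ y) := hα'.inner_smul_riemannianVolumeForm hβ' o₁ ho₁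
    have hpb := isSmoothForm_pullback Φ.contMDiff hsm
    convert hpb using 1
    funext x
    exact (compContinuousLinearMap_inner_smul_riemannianVolumeForm o₀ o₁ _ _ Φ x (b x) (hb x)).symm
  refine abs_integral_sub_l2Inner_le o₀ ho₀ hF hα hβ fun x ↦ ?_
  -- pointwise: the estimate of `AlternatingFormInnerTransport`
  set T := Φ.mfderivToContinuousLinearEquiv (by simp) x with hTdef
  have hpa := pullback_symm_apply_apply Φ α x
  have hpb := pullback_symm_apply_apply Φ β x
  have hTb : ∀ i j, |⟪T (b x i), T (b x j)⟫ - (if i = j then 1 else 0)| ≤ δ := hT x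
  have key := hB (o₀ x) T (b x) (hb x) hδ0 hδ hTb (α x) (β x)
  rw [hΦ x] at key
  have hinner : MForm.inner n (α.pullback I₁ Φ.symm) (β.pullback I₁ Φ.symm) (Φ x) =
      alternatingFormInner (TangentSpace I₁ (Φ x)) n k
        ((α x).compContinuousLinearMap (T.symm : TangentSpace I₁ (Φ x) →L[ℝ] TangentSpace I₀ x))
        ((β x).compContinuousLinearMap (T.symm : TangentSpace I₁ (Φ x) →L[ℝ] TangentSpace I₀ x)) := by
    simp only [MForm.inner, hpa, hpb, hTdef]
  rw [hinner]
  exact key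

end Real

/-! ### Complex forms -/

section Complex

variable {E₀ : Type*} [NormedAddCommGroup E₀] [NormedSpace ℂ E₀] [FiniteDimensional ℂ E₀]
  {n : ℕ} [Fact (finrank ℝ E₀ = n)] [MeasurableSpace E₀] [BorelSpace E₀]
  {M₀ : Type*} [TopologicalSpace M₀] [ChartedSpace E₀ M₀] [T2Space M₀] [CompactSpace M₀]
  [IsManifold 𝓘(ℝ, E₀) ∞ M₀] [RiemannianBundle (fun x : M₀ ↦ TangentSpace 𝓘(ℝ, E₀) x)]
  [IsContMDiffRiemannianBundle 𝓘(ℝ, E₀) ∞ E₀ (fun x : M₀ ↦ TangentSpace 𝓘(ℝ, E₀) x)]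
  (o₀ : (x : M₀) → Orientation ℝ (TangentSpace 𝓘(ℝ, E₀) x) (Fin n))

/-- **Transport of the Hermitian `L²` product along an almost isometric diffeomorphism (complex
forms).** In the setting of `exists_forall_abs_l2Inner_transport_sub_le`, for manifolds modelled
on complex vector spaces and the Hermitian product `( , )_{L²}` of complex `k`-forms
(`MForm.cl2Inner`, Voisin (2002), §5.1.1, eq. (5.1) complexified), for every `ε > 0` there is
`δ₀ > 0` such that for Gram defect `≤ δ ≤ δ₀`,
`‖((Φ⁻¹)^*a, (Φ⁻¹)^*b)_{L²(M₁)} - (a, b)_{L²(M₀)}‖ ≤ 2ε (‖a‖² + ‖b‖²)` for all smooth complex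
`k`-forms `a, b` on `M₀`, where `‖a‖² = Re (a, a)_{L²(M₀)}`. Proof: real and imaginary parts
(`MForm.re_pullback`, `MForm.im_pullback`) and the real statement applied to the four pairs.
The metric-comparison step of the soft proof of Voisin (2002), Prop. 9.20.
[cite: VoisinHodgeI2002, §9.3.2, Prop. 9.20] -/
theorem exists_forall_norm_cl2Inner_transport_sub_le
    (ho₀ : IsSmoothForm (riemannianVolumeForm o₀))
    (b : ∀ x : M₀, OrthonormalBasis (Fin n) ℝ (TangentSpace 𝓘(ℝ, E₀) x))
    (hb : ∀ x, (b x).toBasis.orientation = o₀ x) (k : ℕ) {ε : ℝ} (hε : 0 < ε) :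
    ∃ δ₀ : ℝ, 0 < δ₀ ∧ ∀ {E₁ : Type u₁} [NormedAddCommGroup E₁] [NormedSpace ℂ E₁]
      [FiniteDimensional ℂ E₁] [Fact (finrank ℝ E₁ = n)] [MeasurableSpace E₁] [BorelSpace E₁]
      {M₁ : Type u₃} [TopologicalSpace M₁] [ChartedSpace E₁ M₁] [T2Space M₁] [CompactSpace M₁]
      [IsManifold 𝓘(ℝ, E₁) ∞ M₁] [RiemannianBundle (fun y : M₁ ↦ TangentSpace 𝓘(ℝ, E₁) y)]
      [IsContMDiffRiemannianBundle 𝓘(ℝ, E₁) ∞ E₁ (fun y : M₁ ↦ TangentSpace 𝓘(ℝ, E₁) y)]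
      (o₁ : (y : M₁) → Orientation ℝ (TangentSpace 𝓘(ℝ, E₁) y) (Fin n))
      (_ho₁ : IsSmoothForm (riemannianVolumeForm o₁)) (Φ : Diffeomorph 𝓘(ℝ, E₀) 𝓘(ℝ, E₁) M₀ M₁ ∞)
      (_hΦ : ∀ x, Orientation.map (Fin n)
        (Φ.mfderivToContinuousLinearEquiv (by simp) x).toLinearEquiv (o₀ x) = o₁ (Φ x))
      {δ : ℝ} (_hδ0 : 0 ≤ δ) (_hδ : δ ≤ δ₀)
      (_hT : ∀ x i j, |⟪mfderiv 𝓘(ℝ, E₀) 𝓘(ℝ, E₁) Φ x (b x i),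
        mfderiv 𝓘(ℝ, E₀) 𝓘(ℝ, E₁) Φ x (b x j)⟫ - (if i = j then 1 else 0)| ≤ δ)
      {a c : MForm 𝓘(ℝ, E₀) M₀ ℂ k} (_ha : IsSmoothForm a) (_hc : IsSmoothForm c),
      ‖MForm.cl2Inner o₁ (a.pullback 𝓘(ℝ, E₁) Φ.symm) (c.pullback 𝓘(ℝ, E₁) Φ.symm) -
          MForm.cl2Inner o₀ a c‖ ≤
        2 * ε * ((MForm.cl2Inner o₀ a a).re + (MForm.cl2Inner o₀ c c).re) := by
  obtain ⟨δ₀, hδ₀, hR⟩ := exists_forall_abs_l2Inner_transport_sub_le o₀ ho₀ b hb k hε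
  refine ⟨δ₀, hδ₀, ?_⟩
  intro E₁ _ _ _ _ _ _ M₁ _ _ _ _ _ _ _ o₁ ho₁ Φ hΦ δ hδ0 hδ hT a c ha hc
  have h := fun {α β : MForm 𝓘(ℝ, E₀) M₀ ℝ k} (hα : IsSmoothForm α) (hβ : IsSmoothForm β) ↦
    hR o₁ ho₁ Φ hΦ hδ0 hδ hT hα hβ
  have h1 := h ha.re hc.re
  have h2 := h ha.im hc.im
  have h3 := h ha.re hc.im
  have h4 := h ha.im hc.re
  -- real and imaginary parts of the difference
  set z := MForm.cl2Inner o₁ (a.pullback 𝓘(ℝ, E₁) Φ.symm) (c.pullback 𝓘(ℝ, E₁) Φ.symm) -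
    MForm.cl2Inner o₀ a c with hz
  have hre : z.re =
      (MForm.l2Inner o₁ (a.re.pullback 𝓘(ℝ, E₁) Φ.symm) (c.re.pullback 𝓘(ℝ, E₁) Φ.symm) -
          MForm.l2Inner o₀ a.re c.re) +
        (MForm.l2Inner o₁ (a.im.pullback 𝓘(ℝ, E₁) Φ.symm) (c.im.pullback 𝓘(ℝ, E₁) Φ.symm) -
          MForm.l2Inner o₀ a.im c.im) := by
    simp only [hz, MForm.cl2Inner, MForm.re_pullback, MForm.im_pullback, Complex.sub_re,
      Complex.add_re, Complex.mul_re, Complex.ofReal_re, Complex.ofReal_im, Complex.I_re,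
      Complex.I_im]
    ring
  have him : z.im =
      (MForm.l2Inner o₁ (a.re.pullback 𝓘(ℝ, E₁) Φ.symm) (c.im.pullback 𝓘(ℝ, E₁) Φ.symm) -
          MForm.l2Inner o₀ a.re c.im) -
        (MForm.l2Inner o₁ (a.im.pullback 𝓘(ℝ, E₁) Φ.symm) (c.re.pullback 𝓘(ℝ, E₁) Φ.symm) -
          MForm.l2Inner o₀ a.im c.re) := by
    simp only [hz, MForm.cl2Inner, MForm.re_pullback, MForm.im_pullback, Complex.sub_im,
      Complex.add_im, Complex.mul_im, Complex.ofReal_re, Complex.ofReal_im, Complex.I_re,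
      Complex.I_im]
    ring
  have haa : (MForm.cl2Inner o₀ a a).re = MForm.l2Inner o₀ a.re a.re + MForm.l2Inner o₀ a.im a.im := by
    simp only [MForm.cl2Inner, Complex.add_re, Complex.mul_re, Complex.ofReal_re,
      Complex.ofReal_im, Complex.I_re, Complex.I_im]
    ring
  have hcc : (MForm.cl2Inner o₀ c c).re = MForm.l2Inner o₀ c.re c.re + MForm.l2Inner o₀ c.im c.im := by
    simp only [MForm.cl2Inner, Complex.add_re, Complex.mul_re, Complex.ofReal_re,
      Complex.ofReal_im, Complex.I_re, Complex.I_im]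
    ring
  calc ‖z‖ ≤ |z.re| + |z.im| := Complex.norm_le_abs_re_add_abs_im z
    _ ≤ 2 * ε * ((MForm.cl2Inner o₀ a a).re + (MForm.cl2Inner o₀ c c).re) := by
      rw [hre, him, haa, hcc]
      have e1 := abs_add_le
        (MForm.l2Inner o₁ (a.re.pullback 𝓘(ℝ, E₁) Φ.symm) (c.re.pullback 𝓘(ℝ, E₁) Φ.symm) -
          MForm.l2Inner o₀ a.re c.re)
        (MForm.l2Inner o₁ (a.im.pullback 𝓘(ℝ, E₁) Φ.symm) (c.im.pullback 𝓘(ℝ, E₁) Φ.symm) -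
          MForm.l2Inner o₀ a.im c.im)
      have e2 := abs_sub
        (MForm.l2Inner o₁ (a.re.pullback 𝓘(ℝ, E₁) Φ.symm) (c.im.pullback 𝓘(ℝ, E₁) Φ.symm) -
          MForm.l2Inner o₀ a.re c.im)
        (MForm.l2Inner o₁ (a.im.pullback 𝓘(ℝ, E₁) Φ.symm) (c.re.pullback 𝓘(ℝ, E₁) Φ.symm) -
          MForm.l2Inner o₀ a.im c.re)
      nlinarith [h1, h2, h3, h4, e1, e2]

end Complex

end Literature.Geometry.Kaehler
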